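import Literature.Computability.Complexity.NPSubsetNTIME
import Literature.Computability.Complexity.ExpTimeMaps
import HarnessLib

/-!
# Upward separation, transfer lemmas: `NP`-preimages under `2^{O(n)}`-time maps are in `NE`;
# `E`-preimages under logarithmically short `FP` maps are in `P`

Topic `Literature/Computability/Complexity`, first proof file of the named fact
`hartmanisImmermanSewelson1985_thm1` (`SparseSetsUpwardSeparation.lean`: Hartmanis–Immerman–Sewelson
1985, Thm. 1, "there is a sparse set in `NP − P` iff `EXPTIME ≠ NEXPTIME`"). The two halves of the
upward separation method (Information and Control 65, pp. 163–164) move between the polynomial and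
the linear-exponential regime along a SHORT NAME of a long object:

* **`preimage_mem_NE_of_mem_FE`** — if `L ∈ NP` and `f` is computable in time `2^{O(n)}` (`f ∈ FE`,
  `ExpTimeMaps.lean`) then `f⁻¹(L) ∈ NE`. This is the step "`S' ∈ NEXPTIME`" of the printed proof
  (p. 164: "given a five-tuple `n#i#j#k#d` we need to guess only a polynomial in `n` number of
  strings of length `n`", the tuple being of length `O(log n)`): the `NE`-verifier on `⟨u, y⟩`
  computes `f u` (time `2^{O(|u|)}`), CUTS the witness to the admissible length `p(|f u|) + 1` of
  the `NP`-presentation of `L` (the truncating wrapper `truncMapAux` of `TruncMapMachine.lean`,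
  reading the discarded rest two symbols per step — this is what makes the tree's one-constant
  verifier form of `NTIME` attainable, exactly as in `NP_subset_NTIME_two_pow`), and runs the
  polynomial-time decider of `LenLe p ⊓ L'` on a word of length `2^{O(|u|)}`.
* **`preimage_mem_P_of_mem_E`** — if `A ∈ E` and `g ∈ FP` has logarithmically short values,
  `|g w| ≤ C log₂ |w| + C`, then `g⁻¹(A) ∈ P`. This is the step "we run an exponential in `log n`
  algorithm at most a polynomial in `n` number of times" (p. 164): one query costs
  `2^{O(log n)} = n^{O(1)}` (sequential composition `TimeComputable.comp_holds`).

Both are assembled from machines the tree already has; nothing is programmed here.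

## References

* J. Hartmanis, N. Immerman, V. Sewelson, *Sparse sets in NP−P: EXPTIME versus NEXPTIME*,
  Information and Control 65 (1985) 158–181, Thm. 1 and its proof, pp. 163–164 (held:
  `paper:doi-10-1016-s0019-9958-85-80004-8`, PDF pp. 6–7). [HartmanisImmermanSewelson1985]
* S. Arora, B. Barak, *Computational Complexity: A Modern Approach*, CUP 2009, Def. 2.1, Thm. 2.6,
  §2.6.2 (padding / translation upward), §1.3 (Claim 1.6: running times compose). [AroraBarakCC2009]
-/

namespace Literature.Computability.Complexity

open _root_.Computability Turing Polynomial

/-! ### `NP`-preimages under `FE` maps are in `NE` -/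

/-- The witness-independent part of the running time of the `NE`-verifier of
`preimage_mem_NE_of_mem_FE` is exponentially bounded (all its ingredients are: the `FE` clock
`K 2^{cn} + K`, polynomials of the exponentially bounded output length `s n`). [folklore] -/
theorem isExpBounded_verifierTime (K c a k : ℕ) (p q : Polynomial ℕ) {s : ℕ → ℕ}
    (hs : IsExpBounded s) :
    IsExpBounded fun n => K * 2 ^ (c * n) + K + q.eval (s n) + 3 * s n + 2 * (p.eval (s n) + 1) +
      2 * n + 11 + (a * (2 * s n + 3 + p.eval (s n)) ^ k + a) + p.eval (s n) := by
  have h1 : IsExpBounded fun n => K * 2 ^ (c * n) + K := IsExpBounded.shape c K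
  have h2 : IsExpBounded fun n => q.eval (s n) := hs.poly_comp q
  have h3 : IsExpBounded fun n => p.eval (s n) := hs.poly_comp p
  have h4 : IsExpBounded fun n => 2 * s n + 3 + p.eval (s n) :=
    ((hs.const_mul 2).add (IsExpBounded.const 3)).add h3
  exact ((((((h1.add h2).add (hs.const_mul 3)).add ((h3.add (IsExpBounded.const 1)).const_mul 2)).add
    (IsExpBounded.id.const_mul 2)).add (IsExpBounded.const 11)).add
      (((h4.pow k).const_mul a).add (IsExpBounded.const a))).add h3

/-- **`NP`-preimages under `2^{O(n)}`-time maps are in `NE`** (the upward translation behind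
Hartmanis–Immerman–Sewelson 1985, Thm. 1, p. 164: "From these we see that `S' ∈ NEXPTIME`"; cf.
Book 1974 and Arora–Barak 2009, §2.6.2). For `L ∈ NP` presented by `L' ∈ P` and the witness
polynomial `p`, and `f ∈ FE` with machine `F` (time `K 2^{c|u|} + K`, output length `≤ s(|u|)`,
`s` exponentially bounded), the verifier of `f⁻¹(L)` on `⟨u, y⟩` is the truncating wrapper
`truncMapAux (F ; N)` of the clock `u ↦ ⟨f u, 1^{p(|f u|)+1}⟩` — output `⟨f u, y ↾ (p(|f u|)+1)⟩`
within `2^{O(|u|)} + |y| / 2` steps — followed by a polynomial-time decider of `LenLe p ⊓ L'`; the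
relation "`y ↾ (p(|f u|)+1)` is admissible and `⟨f u, y ↾ …⟩ ∈ L'`" has exactly the `NP`-witnesses of
`f u` as witnesses. With `B 2^{c₁ n} + B` dominating the witness-independent time, the language is
in `NTIME(2^{c₁ n})` with constant `2B + 2`.
[cite: HartmanisImmermanSewelson1985, Theorem 1 (proof, p. 164)] -/
theorem preimage_mem_NE_of_mem_FE {L : Language Bool} (hL : L ∈ Nondeterministic.NP)
    {f : List Bool → List Bool} (hf : f ∈ FE) : (f ⁻¹' L : Language Bool) ∈ NE := by
  obtain ⟨L', hL'P, p, hLp⟩ := hL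
  -- a decider of `LenLe p ⊓ L'`
  have hL'' : LenLe p ⊓ L' ∈ Classes.P := inter_mem_P (LenLe_mem_P p) hL'P
  simp only [Classes.P, Set.mem_iUnion] at hL''
  obtain ⟨k, a, hdec⟩ := hL''
  obtain ⟨M, hM⟩ := (hdec : TimeDecidable id (LenLe p ⊓ L') fun n => a * n ^ k + a)
  -- the `FE` machine of `f`, its output length, the polynomial clock
  obtain ⟨s, hs, -, hsl⟩ := exists_length_le_of_mem_FE hf
  obtain ⟨c, K, F, hF⟩ := mem_FE_iff.1 hf
  obtain ⟨q, N, hN⟩ := exists_machine_pair_ones p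
  obtain ⟨c₁, B, hB⟩ := (isExpBounded_verifierTime K c a k p q hs).exists_le_mul_add
  -- membership in `NTIME(2^{c₁ n})` with constant `2B + 2`
  refine Set.mem_iUnion.2 ⟨c₁, 2 * B + 2,
    fun u y => (LenLe p ⊓ L').boolIndicator (boolPair (f u) (y.take (p.eval (f u).length + 1))),
    (truncMapAux (F.comp N)).comp M, fun u y hy => ?_, fun u => ?_⟩
  · -- running time
    have hFu : F.OutputsWithin u (f u) (K * 2 ^ (c * u.length) + K) := hF u
    have hclock := TM2ComputableAux.comp_outputsWithin F N hFu (hN (f u))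
    have h₁ := outputsWithin_truncMapAux_boolPair (F.comp N) (y := y) hclock
    simp only [List.length_replicate] at h₁
    set y' := y.take (p.eval (f u).length + 1) with hy'
    have hlen' : y'.length ≤ p.eval (f u).length + 1 := List.length_take_le _ _
    have h₂ : M.OutputsWithin (boolPair (f u) y') (encodeBool ((LenLe p ⊓ L').boolIndicator
        (boolPair (f u) y'))) (a * (2 * (f u).length + 3 + p.eval (f u).length) ^ k + a) := by
      refine (hM (boolPair (f u) y')).mono ?_
      simp only [id, length_boolPair]
      have : 2 * (f u).length + 2 + y'.length ≤ 2 * (f u).length + 3 + p.eval (f u).length := by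
        omega
      exact Nat.add_le_add_right (Nat.mul_le_mul_left a (Nat.pow_le_pow_left this k)) a
    have h := TM2ComputableAux.comp_outputsWithin _ _ h₁ h₂
    refine h.mono ?_
    have hfs : (f u).length ≤ s u.length := hsl u
    have hq : q.eval (f u).length ≤ q.eval (s u.length) := TM2Iter.eval_mono q hfs
    have hp : p.eval (f u).length ≤ p.eval (s u.length) := TM2Iter.eval_mono p hfs
    have hpow : a * (2 * (f u).length + 3 + p.eval (f u).length) ^ k ≤
        a * (2 * s u.length + 3 + p.eval (s u.length)) ^ k :=
      Nat.mul_le_mul_left a (Nat.pow_le_pow_left (by omega) k)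
    have hBn := hB u.length
    have hP2 : (2 * B + 2) * 2 ^ (c₁ * u.length) =
        2 * (B * 2 ^ (c₁ * u.length)) + 2 * 2 ^ (c₁ * u.length) := by ring
    have hy2 : 2 * (y.length / 2) ≤ 2 * (B * 2 ^ (c₁ * u.length)) + 2 * 2 ^ (c₁ * u.length) + (2 * B + 2) :=
      (Nat.mul_div_le y.length 2).trans (hP2 ▸ hy)
    show _ ≤ (2 * B + 2) * 2 ^ (c₁ * u.length) + (2 * B + 2)
    rw [hP2]
    omega
  · -- correctness
    have hind : ∀ w : List Bool, (LenLe p ⊓ L').boolIndicator w = true ↔ w ∈ LenLe p ∧ w ∈ L' :=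
      fun w => (Set.mem_iff_boolIndicator ((LenLe p ⊓ L' : Language Bool) : Set (List Bool)) w).symm
    change f u ∈ L ↔ _
    rw [hLp (f u)]
    constructor
    · rintro ⟨y₀, hy₀, hmem⟩
      refine ⟨y₀, ?_, ?_⟩
      · have hBn := hB u.length
        have hp : p.eval (f u).length ≤ p.eval (s u.length) := TM2Iter.eval_mono p (hsl u)
        have hP2 : (2 * B + 2) * 2 ^ (c₁ * u.length) =
            2 * (B * 2 ^ (c₁ * u.length)) + 2 * 2 ^ (c₁ * u.length) := by ring
        show y₀.length ≤ (2 * B + 2) * 2 ^ (c₁ * u.length) + (2 * B + 2)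
        rw [hP2]
        omega
      · rw [hind, List.take_of_length_le (by omega), boolPair_mem_LenLe]
        exact ⟨hy₀, hmem⟩
    · rintro ⟨y, -, hR⟩
      rw [hind, boolPair_mem_LenLe] at hR
      exact ⟨_, hR.1, hR.2⟩

/-- **`NE = E` turns `NP`-preimages under `FE` maps into `E` languages** (the use made of the
hypothesis `EXPTIME = NEXPTIME` in Hartmanis–Immerman–Sewelson 1985, Thm. 1, p. 164: "Since we
assumed that `EXPTIME = NEXPTIME`, we now know that `S' ∈ EXPTIME`").
[cite: HartmanisImmermanSewelson1985, Theorem 1 (proof, p. 164)] -/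
theorem preimage_mem_E_of_mem_FE_of_E_eq_NE (hE : E = NE) {L : Language Bool}
    (hL : L ∈ Nondeterministic.NP) {f : List Bool → List Bool} (hf : f ∈ FE) :
    (f ⁻¹' L : Language Bool) ∈ E := by
  rw [hE]
  exact preimage_mem_NE_of_mem_FE hL hf

/-! ### `E`-preimages under logarithmically short `FP` maps are in `P` -/

/-- `2^{c (C log₂ n + C)} ≤ 2^{cC} (n + 1)^{cC}`. [folklore] -/
theorem two_pow_mul_log_le (c C n : ℕ) :
    2 ^ (c * (C * Nat.log 2 n + C)) ≤ 2 ^ (c * C) * (n + 1) ^ (c * C) := by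
  have hlog : 2 ^ Nat.log 2 n ≤ n + 1 := by
    rcases Nat.eq_zero_or_pos n with rfl | hn
    · simp
    · exact (Nat.pow_log_le_self 2 hn.ne').trans (Nat.le_succ n)
  calc 2 ^ (c * (C * Nat.log 2 n + C)) = (2 ^ Nat.log 2 n) ^ (c * C) * 2 ^ (c * C) := by
        rw [show c * (C * Nat.log 2 n + C) = Nat.log 2 n * (c * C) + c * C by ring, pow_add, pow_mul]
    _ ≤ (n + 1) ^ (c * C) * 2 ^ (c * C) := Nat.mul_le_mul_right _ (Nat.pow_le_pow_left hlog _)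
    _ = 2 ^ (c * C) * (n + 1) ^ (c * C) := Nat.mul_comm _ _

/-- **`E`-preimages under logarithmically short polynomial-time maps are in `P`** (the query step
of Hartmanis–Immerman–Sewelson 1985, Thm. 1, p. 164: "we run an exponential in `log n` algorithm at
most a polynomial in `n` number of times"): if `A ∈ E` is decided in time `a 2^{cm} + a` and
`g ∈ FP` satisfies `|g w| ≤ C log₂ |w| + C`, then `w ↦ [g w ∈ A]` takes
`poly(|w|) + a 2^{c (C log₂|w| + C)} + a ≤ poly(|w|) + a 2^{cC} (|w| + 1)^{cC} + a` steps
(`TimeComputable.comp_holds`), so `g⁻¹(A) ∈ P`.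
[cite: HartmanisImmermanSewelson1985, Theorem 1 (proof, p. 164)] -/
theorem preimage_mem_P_of_mem_E {A : Language Bool} (hA : A ∈ E) {g : List Bool → List Bool}
    (hg : g ∈ FP) (C : ℕ) (hlen : ∀ w, (g w).length ≤ C * Nat.log 2 w.length + C) :
    (g ⁻¹' A : Language Bool) ∈ Classes.P := by
  rw [E, Set.mem_iUnion] at hA
  obtain ⟨c, a, hdec⟩ := hA
  have hdec' : TimeComputable (id : List Bool → List Bool) encodeBool A.boolIndicator
      fun n => a * 2 ^ (c * n) + a := hdec
  obtain ⟨p, hp⟩ := hg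
  obtain ⟨D, hD⟩ := TimeComputable.comp_holds hdec' hp (monotone_expLin c a)
    (s := fun n => C * Nat.log 2 n + C) hlen
  have hind : A.boolIndicator ∘ g = (g ⁻¹' A).boolIndicator := by
    funext w
    rfl
  rw [hind] at hD
  set P : Polynomial ℕ := Polynomial.C D * (p + (Polynomial.C (a * 2 ^ (c * C)) * (X + 1) ^ (c * C) +
    Polynomial.C a) + (Polynomial.C C * X + Polynomial.C C)) + Polynomial.C D with hP
  suffices hfin : TimeComputable (id : List Bool → List Bool) encodeBool (g ⁻¹' A).boolIndicator
      fun n => P.eval n from mem_P_iff_holds.2 ⟨P, hfin⟩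
  refine hD.mono fun n => ?_
  have h1 : a * 2 ^ (c * (C * Nat.log 2 n + C)) ≤ a * 2 ^ (c * C) * (n + 1) ^ (c * C) := by
    rw [Nat.mul_assoc]
    exact Nat.mul_le_mul_left a (two_pow_mul_log_le c C n)
  have h2 : C * Nat.log 2 n ≤ C * n := Nat.mul_le_mul_left C (Nat.log_le_self 2 n)
  simp only [hP, eval_add, eval_mul, eval_C, eval_X, eval_pow, eval_one]
  have h3 : p.eval n + (a * 2 ^ (c * (C * Nat.log 2 n + C)) + a) + (C * Nat.log 2 n + C) ≤
      p.eval n + (a * 2 ^ (c * C) * (n + 1) ^ (c * C) + a) + (C * n + C) := by omega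
  exact Nat.add_le_add_right (Nat.mul_le_mul_left D h3) D

/-- The same with the hypothesis `E = NE` and an `NP`-language behind an `FE` map: for `L ∈ NP`,
`f ∈ FE` and a logarithmically short `g ∈ FP`, the language `{w | f (g w) ∈ L}` is in `P` — the
composite of the two transfer lemmas, in the shape consumed by the census argument
(`SparseSetsUpwardSeparationProofs.lean`). [cite: HartmanisImmermanSewelson1985, Theorem 1 (proof, p. 164)] -/
theorem preimage_preimage_mem_P_of_E_eq_NE (hE : E = NE) {L : Language Bool}
    (hL : L ∈ Nondeterministic.NP) {f : List Bool → List Bool} (hf : f ∈ FE)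
    {g : List Bool → List Bool} (hg : g ∈ FP) (C : ℕ)
    (hlen : ∀ w, (g w).length ≤ C * Nat.log 2 w.length + C) :
    (g ⁻¹' (f ⁻¹' L) : Language Bool) ∈ Classes.P :=
  preimage_mem_P_of_mem_E (preimage_mem_E_of_mem_FE_of_E_eq_NE hE hL hf) hg C hlen

end Literature.Computability.Complexity
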